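import Summits.KontsevichZagierPeriods.KontsevichZagierPeriods.Theorems.MzvKernelInKZTwoPosetsCubicalChart
import Summits.KontsevichZagierPeriods.KontsevichZagierPeriods.Theses.FurushoPentagon
import Literature.NumberTheory.Transcendental.KZProductIdeal

/-!
# `DoubleShuffleInKZ` (stmt-KontsevichZagierPeriods-14665, route `FurushoPentagon`): the Λ-chart

Helper file (`--supports stmt-KontsevichZagierPeriods-14665`), line "rider lever" for the
Kaneko–Yamamoto integral–series family `IS_j(u)`.  THE START OF THE LINE (`lambda_chart`): the mixed
representation with `j` riders at the top block of an admissible `u` (weight `c + 1`),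
`C_j(u, 0) = [{x ∈ (0,1)^{c+1}, 0 < v₀ < ⋯ < v_{j-1} < x₀}, f_u(x) ∏_a 1/(1 − v_a)]` (cubical word
block), is congruent modulo `KZ.relations` to the `Λ`-poset representation of
`FurushoPentagonDoubleShuffleInKZLambdaCells.lean`,
`[{1 > t₀ > v'₀ > ⋯, t₀ > s₀ > ⋯ > s_{c-1}}, (1/t₀) ∏ 1/(1 − v'_a) ∏ ω_{ε'_i}(s_i)]`
(`ε'` = the letters of `u` after the first, `v' = v` reversed): ONE change of variables along the
monomial chart `tᵢ = x₀ ⋯ xᵢ` on the word block, identity on the riders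
(`HoffmanRelationInKZ.monomialChart_transport`; Jacobian `∏ᵢ T_i(x)`, pull-back identity
`HoffmanRelationInKZ.stub_cubicalPullback`), followed by ONE coordinate relabelling (riders reversed,
`t₀` moved to the front).

References: M. Kontsevich, D. Zagier, *Periods* (2001), §1.2 rule (2); M. Kaneko, S. Yamamoto,
Selecta Math. 24 (2018), Thm 4.1.
-/

noncomputable section

open Set MeasureTheory
open Literature.NumberTheory.Transcendental
open Literature.ModelTheory.ExponentialFields (IsSemialgebraic)
open Summit.KontsevichZagierPeriods.MzvKernelInKZ.Negative
open Summit.KontsevichZagierPeriods.MzvKernelInKZ.TwoPosets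
open Summit.KontsevichZagierPeriods.FurushoPentagon.HoffmanRelationInKZ

namespace Summit.KontsevichZagierPeriods.FurushoPentagon.DoubleShuffleInKZ

/-! ### Block partial products -/

/-- The partial products of the word block, read in the full coordinates: for `k = j + i`,
`∏_{l : j ≤ l ≤ k} z_l = ∏_{i' ≤ i} x_{i'}` with `x_{i'} = z_{j+i'}`. [folklore] -/
theorem prod_filter_block {j n : ℕ} (z : Fin (j + n) → ℝ) (i : Fin n) :
    ∏ l ∈ Finset.univ.filter (fun l : Fin (j + n) => j ≤ (l : ℕ) ∧ (l : ℕ) ≤ j + i), z l =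
      ∏ i' ∈ Finset.univ.filter (fun i' : Fin n => i' ≤ i), z (Fin.natAdd j i') := by
  have hset : Finset.univ.filter (fun l : Fin (j + n) => j ≤ (l : ℕ) ∧ (l : ℕ) ≤ j + i) =
      (Finset.univ.filter (fun i' : Fin n => i' ≤ i)).image (Fin.natAdd j) := by
    ext l
    simp only [Finset.mem_filter, Finset.mem_univ, true_and, Finset.mem_image, Fin.le_def]
    constructor
    · rintro ⟨h1, h2⟩
      exact ⟨⟨(l : ℕ) - j, by omega⟩, by simp; omega, by ext; simp; omega⟩
    · rintro ⟨i', hi', rfl⟩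
      simp; omega
  rw [hset, Finset.prod_image (fun a _ b _ h => by simpa using h)]

/-- The filtered product over `i' ≤ i` is Kontsevich's partial product `T_{i+1}`. [folklore] -/
theorem prod_filter_le_eq_prod_ite {n : ℕ} (x : Fin n → ℝ) (i : Fin n) :
    ∏ i' ∈ Finset.univ.filter (fun i' : Fin n => i' ≤ i), x i' =
      ∏ i' : Fin n, (if (i' : ℕ) < (i : ℕ) + 1 then x i' else 1) := by
  rw [Finset.prod_filter]
  refine Finset.prod_congr rfl fun i' _ => ?_
  by_cases h : i' ≤ i
  · rw [if_pos h, if_pos (by rw [Fin.le_def] at h; omega)]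
  · rw [if_neg h, if_neg (by rw [Fin.le_def] at h; omega)]

/-- The filtered product over `j ≤ l < j + i` is `T_i`. [folklore] -/
theorem prod_filter_block_lt {j n : ℕ} (z : Fin (j + n) → ℝ) (i : Fin n) :
    ∏ l ∈ (Finset.univ.filter (fun l : Fin (j + n) => j ≤ (l : ℕ) ∧ (l : ℕ) ≤ j + i)).erase
        (Fin.natAdd j i), z l =
      ∏ i' : Fin n, (if (i' : ℕ) < (i : ℕ) then z (Fin.natAdd j i') else 1) := by
  have hset : (Finset.univ.filter (fun l : Fin (j + n) => j ≤ (l : ℕ) ∧ (l : ℕ) ≤ j + i)).erase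
      (Fin.natAdd j i) = Finset.univ.filter (fun l : Fin (j + n) => j ≤ (l : ℕ) ∧ (l : ℕ) < j + i) := by
    ext l
    simp only [Finset.mem_erase, Finset.mem_filter, Finset.mem_univ, true_and, ne_eq, Fin.ext_iff,
      Fin.val_natAdd]
    omega
  rw [hset, Finset.prod_filter]
  rw [← Finset.prod_subset (Finset.subset_univ ((Finset.univ : Finset (Fin n)).image (Fin.natAdd j)))
    (fun l _ hl => ?_)]
  · rw [Finset.prod_image (fun a _ b _ h => by simpa using h)]
    refine Finset.prod_congr rfl fun i' _ => ?_
    simp only [Fin.val_natAdd]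
    by_cases h : (i' : ℕ) < i
    · rw [if_pos (by omega), if_pos h]
    · rw [if_neg (by omega), if_neg h]
  · simp only [Finset.mem_image, Finset.mem_univ, true_and, not_exists] at hl
    rw [if_neg]
    rintro ⟨h1, h2⟩
    exact hl ⟨(l : ℕ) - j, by omega⟩ (by ext; simp; omega)

/-- Reversal turns strictly increasing riders into a strictly decreasing tuple. [folklore] -/
theorem strictAnti_comp_rev_iff {j : ℕ} (v : Fin j → ℝ) :
    StrictAnti (fun a : Fin j => v (Fin.rev a)) ↔ StrictMono v := by
  constructor
  · intro h a b hab
    have := h (show Fin.rev b < Fin.rev a from Fin.rev_lt_rev.mpr hab)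
    simpa using this
  · intro h a b hab
    exact h (Fin.rev_lt_rev.mpr hab)

/-- A tuple on `Fin (c+1)` is strictly decreasing iff it decreases at the first step and its tail
is strictly decreasing. [folklore] -/
theorem strictAnti_iff_head_tail {c : ℕ} (t : Fin (c + 1) → ℝ) :
    StrictAnti t ↔ (∀ h : 0 < c, t ⟨1, by omega⟩ < t 0) ∧ StrictAnti (fun b : Fin c => t b.succ) := by
  constructor
  · intro h
    exact ⟨fun hc => h (show (0 : Fin (c + 1)) < ⟨1, by omega⟩ by simp [Fin.lt_def]),
      fun a b hab => h (Fin.succ_lt_succ_iff.mpr hab)⟩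
  · rintro ⟨h0, htail⟩ a b hab
    rcases Fin.eq_zero_or_eq_succ b with rfl | ⟨b', rfl⟩
    · exact absurd hab (not_lt.mpr (Fin.zero_le _))
    · rcases Fin.eq_zero_or_eq_succ a with rfl | ⟨a', rfl⟩
      · have hc : 0 < c := b'.pos
        calc t b'.succ ≤ t (⟨0, hc⟩ : Fin c).succ := htail.antitone (Fin.le_def.mpr (Nat.zero_le _))
          _ < t 0 := by simpa using h0 hc
      · exact htail (Fin.succ_lt_succ_iff.mp hab)

/-- Kontsevich's pull-back identity along the monomial chart (`stub_cubicalPullback`), with the word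
block indexed by `Fin M` for any `M = weight u`. [cite: KontsevichZagier2001, §1.2] -/
theorem pullback_cast (u : List ℕ) (hu1 : ∀ a ∈ u, 1 ≤ a) {M : ℕ} (hM : MZV.weight u = M)
    (x : Fin M → ℝ) (hx : ∀ i, x i ≠ 0) :
    (∏ i : Fin M, KZ.mzvForm ((MZV.binaryWord u).getD i false)
        (∏ i' : Fin M, if (i' : ℕ) < (i : ℕ) + 1 then x i' else 1)) *
      ∏ i : Fin M, (∏ i' : Fin M, if (i' : ℕ) < (i : ℕ) then x i' else 1) =
    ∏ l : Fin u.length, (∏ i' : Fin M, if (i' : ℕ) < (u.take l).sum then x i' else 1) /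
      (1 - ∏ i' : Fin M, if (i' : ℕ) < (u.take ((l : ℕ) + 1)).sum then x i' else 1) := by
  subst hM
  exact stub_cubicalPullback u hu1 (fun m x => ∏ i' : Fin (MZV.weight u), if (i' : ℕ) < m then x i' else 1)
    (fun _ _ => rfl) x hx

/-- **The Λ-chart** (start of the line "rider lever").  For an admissible nonempty `u` of weight
`N = c + 1` and `j ≥ 1` riders, every representation of the mixed cubical shape `C_j(u, 0)` (riders
first, increasing, the top rider below `x₀`; word block cubical) is congruent modulo `KZ.relations` to
every representation of the `Λ`-poset shape of `lambda_cells` (coordinates `[t₀; v reversed; t₁ …]`,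
simplicial word block with letters `ε'ᵢ = (binaryWord u)_{i+1}`): the monomial chart on the word block
(`monomialChart_transport`, rows `S_k = {k}` for riders and `S_{j+i} = {j, …, j+i}` for the block;
Jacobian `∏ᵢ T_i(x) > 0`; pull-back identity `stub_cubicalPullback`) followed by the coordinate
relabelling `KZ.of_sub_of_reindex_mem_relations`. [cite: KontsevichZagier2001, §1.2] -/
theorem lambda_chart (u : List ℕ) (hu : MZV.IsAdmissible u) (hne : u ≠ []) (j c N : ℕ) (hj : 0 < j)
    (hc0 : 0 < c) (hN : MZV.weight u = N) (hcN : N = c + 1)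
    (r : KZ.IntegralRep (j + N))
    (hrd : r.domain = {z : Fin (j + N) → ℝ |
        (∀ i : Fin N, z (Fin.natAdd j i) ∈ Set.Ioo (0:ℝ) 1) ∧
        (∀ a : Fin j, z (Fin.castAdd N a) ∈ Set.Ioo (0:ℝ) 1) ∧
        (∀ a b : Fin j, a < b → z (Fin.castAdd N a) < z (Fin.castAdd N b)) ∧
        (∀ a : Fin j, (a : ℕ) + 1 = j → ∀ i : Fin N, (i : ℕ) = (u.take 0).sum →
          z (Fin.castAdd N a) < z (Fin.natAdd j i))})
    (hri : Set.EqOn r.integrand (fun z => (∏ l : Fin u.length,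
        (∏ t : Fin N, if (t : ℕ) < (u.take l).sum then z (Fin.natAdd j t) else 1) /
        (1 - (∏ t : Fin N, if (t : ℕ) < (u.take ((l : ℕ) + 1)).sum then z (Fin.natAdd j t) else 1))) *
        ∏ a : Fin j, 1 / (1 - z (Fin.castAdd N a))) r.domain)
    (r' : KZ.IntegralRep (j + c + 1))
    (hr'd : r'.domain = {z : Fin (j + c + 1) → ℝ |
        (∀ k, z k ∈ Set.Ioo (0:ℝ) 1) ∧
        StrictAnti (fun a : Fin j => z (Fin.castAdd c a).succ) ∧
        StrictAnti (fun i : Fin c => z (Fin.natAdd j i).succ) ∧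
        z (Fin.castAdd c ⟨0, hj⟩).succ < z 0 ∧ z (Fin.natAdd j ⟨0, hc0⟩).succ < z 0})
    (hr'i : Set.EqOn r'.integrand (fun z => 1 / z 0 * ((∏ a : Fin j, 1 / (1 - z (Fin.castAdd c a).succ)) *
        ∏ i : Fin c, (if (MZV.binaryWord u).getD ((i : ℕ) + 1) false then 1 / (1 - z (Fin.natAdd j i).succ)
          else 1 / z (Fin.natAdd j i).succ))) r'.domain) :
    KZ.of r - KZ.of r' ∈ KZ.relations := by
  subst hcN
  have hb0 : (MZV.binaryWord u).getD 0 false = false := by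
    obtain ⟨a₀, s₀, rfl⟩ := List.exists_cons_of_ne_nil hne
    exact MZV.getD_binaryWord_cons_zero (hu.2 (List.cons_ne_nil _ _))
  /- 1. the relabelling `E : [t₀; v reversed; t₁ …] ← [v; t]` -/
  have h1 : j + c + 1 = j + (c + 1) := by omega
  let P : Fin (j + c + 1) := ⟨j, by omega⟩
  let Erev : Fin (j + (c + 1)) ≃ Fin (j + (c + 1)) :=
    finSumFinEquiv.symm.trans ((Equiv.sumCongr Fin.revPerm (Equiv.refl (Fin (c + 1)))).trans finSumFinEquiv)
  let E : Fin (j + c + 1) ≃ Fin (j + (c + 1)) := P.cycleRange.symm.trans ((finCongr h1).trans Erev)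
  have hErev_l : ∀ a : Fin j, Erev (Fin.castAdd (c + 1) a) = Fin.castAdd (c + 1) (Fin.rev a) := by
    intro a; simp [Erev]
  have hErev_r : ∀ i : Fin (c + 1), Erev (Fin.natAdd j i) = Fin.natAdd j i := by
    intro i; simp [Erev]
  have hP0 : Fin.cast h1 P = Fin.natAdd j (0 : Fin (c + 1)) := by ext; simp [P]
  have hE0 : E 0 = Fin.natAdd j (0 : Fin (c + 1)) := by
    simp only [E, Equiv.trans_apply, Fin.cycleRange_symm_zero, finCongr_apply, hP0, hErev_r]
  have hPa : ∀ a : Fin j, Fin.cast h1 (P.succAbove (Fin.castAdd c a)) = Fin.castAdd (c + 1) a := by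
    intro a
    rw [Fin.succAbove_of_castSucc_lt _ _ (by rw [Fin.lt_def]; simp [P])]
    ext; simp
  have hEv : ∀ a : Fin j, E (Fin.castAdd c a).succ = Fin.castAdd (c + 1) (Fin.rev a) := by
    intro a
    simp only [E, Equiv.trans_apply, Fin.cycleRange_symm_succ, finCongr_apply, hPa, hErev_l]
  have hPb : ∀ b : Fin c, Fin.cast h1 (P.succAbove (Fin.natAdd j b)) = Fin.natAdd j b.succ := by
    intro b
    rw [Fin.succAbove_of_le_castSucc _ _ (by rw [Fin.le_def]; simp [P])]
    ext; simp; omega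
  have hEs : ∀ b : Fin c, E (Fin.natAdd j b).succ = Fin.natAdd j b.succ := by
    intro b
    simp only [E, Equiv.trans_apply, Fin.cycleRange_symm_succ, finCongr_apply, hPb, hErev_r]
  /- 2. the rows of the chart, its values and its Jacobian -/
  let S : Fin (j + (c + 1)) → Finset (Fin (j + (c + 1))) := fun k =>
    if (k : ℕ) < j then {k} else Finset.univ.filter (fun l => j ≤ (l : ℕ) ∧ (l : ℕ) ≤ (k : ℕ))
  have hS : ∀ k, ∀ l ∈ S k, l ≤ k := by
    intro k l hl
    by_cases hk : (k : ℕ) < j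
    · simp only [S, if_pos hk, Finset.mem_singleton] at hl
      exact hl.le
    · simp only [S, if_neg hk, Finset.mem_filter, Finset.mem_univ, true_and] at hl
      exact Fin.le_def.mpr hl.2
  have hS' : ∀ k, k ∈ S k := by
    intro k
    by_cases hk : (k : ℕ) < j
    · simp only [S, if_pos hk, Finset.mem_singleton]
    · simp only [S, if_neg hk, Finset.mem_filter, Finset.mem_univ, true_and]
      omega
  let Ch : (Fin (j + (c + 1)) → ℝ) → (Fin (j + (c + 1)) → ℝ) := fun y k => ∏ l ∈ S k, y l
  have hCv : ∀ y (a : Fin j), Ch y (Fin.castAdd (c + 1) a) = y (Fin.castAdd (c + 1) a) := by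
    intro y a
    simp only [Ch, S, Fin.val_castAdd, if_pos a.2, Finset.prod_singleton]
  have hCx : ∀ y (i : Fin (c + 1)), Ch y (Fin.natAdd j i) = pprod (fun i' => y (Fin.natAdd j i')) i := by
    intro y i
    simp only [Ch, S, Fin.val_natAdd, if_neg (show ¬ (j + (i : ℕ) < j) by omega)]
    exact prod_filter_block y i
  have hJac : ∀ y : Fin (j + (c + 1)) → ℝ, ∏ k, ∏ l ∈ (S k).erase k, y l =
      ∏ i : Fin (c + 1), ∏ i' : Fin (c + 1), (if (i' : ℕ) < (i : ℕ) then y (Fin.natAdd j i') else 1) := by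
    intro y
    rw [Fin.prod_univ_add]
    have hl : ∏ a : Fin j, ∏ l ∈ (S (Fin.castAdd (c + 1) a)).erase (Fin.castAdd (c + 1) a), y l = 1 := by
      refine Finset.prod_eq_one fun a _ => ?_
      simp only [S, Fin.val_castAdd, if_pos a.2, Finset.erase_singleton, Finset.prod_empty]
    rw [hl, one_mul]
    refine Finset.prod_congr rfl fun i _ => ?_
    simp only [S, Fin.val_natAdd, if_neg (show ¬ (j + (i : ℕ) < j) by omega)]
    exact prod_filter_block_lt y i
  /- 3. the image of `C_j(u,0)` under the chart is the relabelled `Λ`-domain -/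
  have hxcube : ∀ y ∈ r.domain, (fun i' => y (Fin.natAdd j i')) ∈ cube (c + 1) := by
    intro y hy; rw [hrd] at hy; exact fun i => hy.1 i
  have himage : (r'.reindex E).domain = Ch '' r.domain := by
    ext w
    simp only [KZ.IntegralRep.reindex_domain, Set.mem_setOf_eq, hr'd, Set.mem_image, hE0, hEv, hEs]
    constructor
    · rintro ⟨hIoo, hv, hs, hv0, hs0⟩
      have hIoo' : ∀ k, w k ∈ Set.Ioo (0:ℝ) 1 := fun k => by simpa using hIoo (E.symm k)
      have htw : (fun i : Fin (c + 1) => w (Fin.natAdd j i)) ∈ simplex (c + 1) :=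
        ⟨fun i => (hIoo' _).1, fun i => (hIoo' _).2,
          (strictAnti_iff_head_tail _).mpr ⟨fun _ => by simpa using hs0, hs⟩⟩
      obtain ⟨x, hx, hxt⟩ : (fun i : Fin (c + 1) => w (Fin.natAdd j i)) ∈
          cubicalMap (c + 1) '' cube (c + 1) := by rw [image_cubicalMap]; exact htw
      have hx0 : x 0 = w (Fin.natAdd j 0) := by
        have := congrFun hxt 0; rwa [cubicalMap_apply, pprod_zero] at this
      refine ⟨Fin.append (fun a => w (Fin.castAdd (c + 1) a)) x, ?_, ?_⟩
      · rw [hrd]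
        refine ⟨fun i => ?_, fun a => ?_, fun a b hab => ?_, fun a ha i hi => ?_⟩
        · rw [Fin.append_right]; exact hx i
        · rw [Fin.append_left]; exact hIoo' _
        · rw [Fin.append_left, Fin.append_left]; exact (strictAnti_comp_rev_iff (fun a => w (Fin.castAdd (c + 1) a))).mp hv hab
        · rw [Fin.append_left, Fin.append_right]
          have hi0 : i = 0 := Fin.ext (by rw [hi]; simp)
          have ha' : a = Fin.rev ⟨0, hj⟩ := Fin.ext (by simp only [Fin.val_rev]; omega)
          rw [hi0, ha', hx0]
          exact hv0
      · funext k
        refine Fin.addCases (fun a => ?_) (fun i => ?_) k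
        · rw [hCv, Fin.append_left]
        · rw [hCx]
          have hxe : (fun i' => Fin.append (fun a => w (Fin.castAdd (c + 1) a)) x (Fin.natAdd j i')) = x :=
            funext fun i' => Fin.append_right _ _ _
          rw [hxe]
          exact congrFun hxt i
    · rintro ⟨y, hy, rfl⟩
      have hx := hxcube y hy
      rw [hrd] at hy
      obtain ⟨h1y, h2y, h3y, h4y⟩ := hy
      have hsx := cubicalMap_mem_simplex hx
      have hCx' : ∀ i, Ch y (Fin.natAdd j i) = cubicalMap (c + 1) (fun i' => y (Fin.natAdd j i')) i :=
        fun i => hCx y i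
      refine ⟨fun k => ?_, ?_, ?_, ?_, ?_⟩
      · suffices h : ∀ k', Ch y k' ∈ Set.Ioo (0:ℝ) 1 from h (E k)
        intro k'
        refine Fin.addCases (fun a => ?_) (fun i => ?_) k'
        · rw [hCv]; exact h2y a
        · rw [hCx']; exact ⟨hsx.1 i, hsx.2.1 i⟩
      · exact (strictAnti_comp_rev_iff (fun a => Ch y (Fin.castAdd (c + 1) a))).mpr
          (fun a b hab => by dsimp only; rw [hCv, hCv]; exact h3y a b hab)
      · exact fun a b hab => by dsimp only; rw [hCx', hCx']; exact hsx.2.2 (Fin.succ_lt_succ_iff.mpr hab)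
      · rw [hCv, hCx', cubicalMap_apply, pprod_zero]
        exact h4y _ (by simp only [Fin.val_rev]; omega) 0 (by simp)
      · rw [hCx', hCx']
        exact hsx.2.2 (Fin.succ_pos _)
  /- 4. injectivity of the chart -/
  have hinj : Set.InjOn Ch r.domain := by
    intro y hy y' hy' h
    have hb : (fun i' => y (Fin.natAdd j i')) = fun i' => y' (Fin.natAdd j i') := by
      refine injOn_cubicalMap (c + 1) (hxcube y hy) (hxcube y' hy') (funext fun i => ?_)
      have := congrFun h (Fin.natAdd j i)
      rw [hCx, hCx] at this
      exact this
    funext k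
    refine Fin.addCases (fun a => ?_) (fun i => ?_) k
    · have := congrFun h (Fin.castAdd (c + 1) a); rwa [hCv, hCv] at this
    · exact congrFun hb i
  /- 5. the pull-back of the integrand -/
  have hgh : ∀ y ∈ r.domain, (fun z : Fin (j + (c + 1)) → ℝ => (∏ l : Fin u.length,
        (∏ t : Fin (c + 1), if (t : ℕ) < (u.take l).sum then z (Fin.natAdd j t) else 1) /
        (1 - (∏ t : Fin (c + 1), if (t : ℕ) < (u.take ((l : ℕ) + 1)).sum then z (Fin.natAdd j t) else 1))) *
        ∏ a : Fin j, 1 / (1 - z (Fin.castAdd (c + 1) a))) y =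
      (r'.reindex E).integrand (Ch y) * |∏ k, ∏ l ∈ (S k).erase k, y l| := by
    intro y hy
    have hmem : Ch y ∈ (r'.reindex E).domain := by rw [himage]; exact Set.mem_image_of_mem _ hy
    rw [KZ.IntegralRep.reindex_domain, Set.mem_setOf_eq] at hmem
    rw [KZ.IntegralRep.reindex_integrand]
    dsimp only
    rw [hr'i hmem]
    dsimp only
    simp only [hE0, hEv, hEs, hCv, hCx, hJac]
    rw [hrd] at hy
    obtain ⟨h1y, -, -, -⟩ := hy
    have hx0 : ∀ i, (fun i' => y (Fin.natAdd j i')) i ≠ 0 := fun i => (h1y i).1.ne'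
    have hpull : (∏ i : Fin (c + 1), KZ.mzvForm ((MZV.binaryWord u).getD i false)
        (∏ i' : Fin (c + 1), if (i' : ℕ) < (i : ℕ) + 1 then y (Fin.natAdd j i') else 1)) *
        ∏ i : Fin (c + 1), (∏ i' : Fin (c + 1), if (i' : ℕ) < (i : ℕ) then y (Fin.natAdd j i') else 1) =
        ∏ l : Fin u.length, (∏ i' : Fin (c + 1), if (i' : ℕ) < (u.take l).sum then y (Fin.natAdd j i') else 1) /
          (1 - ∏ i' : Fin (c + 1), if (i' : ℕ) < (u.take ((l : ℕ) + 1)).sum then y (Fin.natAdd j i') else 1) :=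
      pullback_cast u hu.1 hN (fun i' => y (Fin.natAdd j i')) hx0
    have hp : ∀ i : Fin (c + 1), pprod (fun i' => y (Fin.natAdd j i')) i =
        ∏ i' : Fin (c + 1), (if (i' : ℕ) < (i : ℕ) + 1 then y (Fin.natAdd j i') else 1) :=
      fun i => prod_filter_le_eq_prod_ite _ i
    have hB : (∏ i : Fin (c + 1), KZ.mzvForm ((MZV.binaryWord u).getD i false)
        (∏ i' : Fin (c + 1), if (i' : ℕ) < (i : ℕ) + 1 then y (Fin.natAdd j i') else 1)) =
        1 / pprod (fun i' => y (Fin.natAdd j i')) 0 *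
          ∏ i : Fin c, (if (MZV.binaryWord u).getD ((i : ℕ) + 1) false then
            1 / (1 - pprod (fun i' => y (Fin.natAdd j i')) i.succ)
            else 1 / pprod (fun i' => y (Fin.natAdd j i')) i.succ) := by
      rw [Fin.prod_univ_succ, Fin.val_zero, hb0]
      simp only [KZ.mzvForm, Fin.val_succ, hp]
      simp
    have hrev : ∏ a : Fin j, (1 / (1 - y (Fin.castAdd (c + 1) (Fin.rev a)))) =
        ∏ a : Fin j, 1 / (1 - y (Fin.castAdd (c + 1) a)) :=
      Equiv.prod_comp Fin.revPerm (fun a => 1 / (1 - y (Fin.castAdd (c + 1) a)))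
    have hJpos : 0 < ∏ i : Fin (c + 1), ∏ i' : Fin (c + 1),
        (if (i' : ℕ) < (i : ℕ) then y (Fin.natAdd j i') else 1) :=
      Finset.prod_pos fun i _ => Finset.prod_pos fun i' _ => by
        split_ifs
        · exact (h1y i').1
        · exact one_pos
    rw [abs_of_pos hJpos, hrev, ← hpull, hB]
    ring
  /- 6. transport and relabel -/
  have hequiv := (monomialChart_transport S hS hS' r.isSemialgebraic_domain Ch (fun _ _ => rfl) hinj _
    (r'.reindex E).integrand hgh).2 r (r'.reindex E) rfl hri himage (fun _ _ => rfl)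
  have h := KZ.relations.sub_mem hequiv (KZ.of_sub_of_reindex_mem_relations r' E)
  rwa [sub_sub_sub_cancel_right] at h

end Summit.KontsevichZagierPeriods.FurushoPentagon.DoubleShuffleInKZ
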